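import Literature.Analysis.Asymptotics.KaramataTauberianLaplace
import Mathlib.Analysis.SpecialFunctions.Gamma.Basic
import Mathlib.Analysis.SpecialFunctions.Gaussian.GaussianIntegral
import HarnessLib

/-!
# Barrier: analytically continued (finite-part) values of divergent convolution integrals are not
# order-preserving — class T4-a «regularised divergent inequality» of the ns-claims map

Barrier catalogue `Literature/Barriers/NavierStokesRegularity/` (D-0021), METHOD-LEVEL entry for
the failure class T4-a of cell `ns-claims` (D-0090 «where NS proofs break» map, §2 technique row
T4 «integral-equation / transform asymptotics»), adjudicated instance: claim C04 `Ramm2024`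
(A. G. Ramm, *Modern Math. Methods* 2 (2024) 19–26), first failing step
`Literature.Claims.NS.Ramm2024.Step3_hyperSingularIneq` = inequality (1.19) p. 22 read as (1.29)
p. 23. Cell record: BREAKS/VERDICT C04 (ns-claims-refuter-2, 2026-08-26T20:27:41Z): first failing step =
`Step3_hyperSingularIneq` ((1.19) p.22 ≡ (1.29) p.23), class = false lemma (countermodel), kernel theorem
`Summit.NavierStokesRegularity.NavierStokesRegularity.Theorems.Ramm2024.not_Step3_hyperSingularIneq`
(p467440; kit ns-claims-typist-4, witness ns-claims-refuter-2, filed by the salvage seat under the cell's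
convention (b)); REF-1 Ramm2024 (ns-claims-ref-1, 2026-08-26T20:31:03Z): FAITHFUL at
`Step3_hyperSingularIneq` vs pp.22–23, charitable retype Step3W = Step3, survives no. The same passage
is Step 2 of the sub-row C04b `Ramm2019` (`Literature.Claims.NS.Ramm2019.Step2_hyperSingularIneq`,
arXiv:1904.11569v1 (e6)→(e10), the 2019 «regularity» reading of the identical inequality). This entry was
proposed after VERDICT + REF (lead ruling 2026-08-26T15:40:46Z).

## The printed mechanism this entry records

Gel'fand–Shilov, *Generalized Functions* I, Ch. I §3.8 «Regularization of other integrals —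
regularization in a finite interval», eq. (3): the integral `∫₀ᵇ x^λ dx`, divergent for
`Re λ ≤ -1`, is given the value `b^{λ+1}/(λ+1)` «for all λ ≠ -1, -2, …», «understood not in the
ordinary sense, but as the regularization according to our rules» (analytic continuation in `λ`
of the convergent integrals, eq. (2) ibid.). At `λ = -5/4` the regularised value of the integral
of the POSITIVE function `x^{-5/4}` over `[0, b]` is `-4 b^{-1/4} < 0`: the regularisation is a
linear but NOT a positive functional, so an inequality `A ≤ B + c ∫₀ᵗ (t-s)^{-5/4} b(s) ds` that is
true classically only because its right-hand side is `+∞` carries NO information about the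
regularised quantity — which may be negative for positive `b`.

In the Laplace-transform form used by integral-equation treatments of the Navier–Stokes Duhamel
formula (Ramm 2024, p. 23: `Φ_λ(t) = t₊^{λ-1}/Γ(λ)`, `LΦ_λ = p^{-λ}` continued analytically to
`Re λ ≤ 0`, `Φ_λ ⋆ q := L^{-1}(p^{-λ} Lq)`): for `q ≡ 1` one gets `Φ_{-1/4} ⋆ 1 = Φ_{3/4}`, i.e.
`w(t) = t^{-1/4}/Γ(3/4) > 0`, and the regularised «`∫₀ᵗ (t-s)^{-5/4} · 1 ds`» is
`Γ(-1/4) w(t) = -4 t^{-1/4} < 0` (`Γ(-1/4) = -4 Γ(3/4)`), while every truncated classical integral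
`∫₀^{t-ε} (t-s)^{-5/4} ds` is positive and tends to `+∞`.

## Formal content (everything PROVED; no named fact is introduced)

* `FinitePartRegularisationNotMonotone` — the entry: there are a strictly positive `b` (namely
  `b ≡ 1`) and a function `w`, continuous on `(0,∞)`, with convergent Laplace integrals and
  `Lw(p) = p^{1/4} Lb(p)` for all `p > 0` (i.e. `w = Φ_{-1/4} ⋆ b` in the sense above — verbatim the
  shape of `Literature.Claims.NS.Ramm2024.IsPhiConv (-1/4) b w`), such that the regularised
  hyper-singular integral `Γ(-1/4) · w(t)` is `< 0` for every `t > 0`.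
  Discharged: `finitePartRegularisationNotMonotone_holds`.
* `laplace_rpow_neg_quarter` — `L(t^{-1/4})(p) = Γ(3/4) p^{-3/4}` (Mathlib's Gamma integral).
* `Gamma_neg_quarter` — `Γ(-1/4) = -4 Γ(3/4) < 0`.
* `FinitePartRegularisationNotMonotone.regularised_ineq_fails` — consequence in the shape of the
  adjudicated step: with `b = b₀ ≡ 1` the «regularised inequality» `b(t) ≤ b₀(t) - c |Γ(-1/4)| w(t)`
  fails at every `t > 0` for every `c > 0`, although `b ≤ b₀` and the classical inequality with the
  divergent kernel holds (its right-hand side being `+∞`).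

## References

* I. M. Gel'fand, G. E. Shilov, *Generalized Functions, Vol. 1* (Academic Press 1964; AMS Chelsea
  2016), Ch. I §3.8, eqs. (2)–(3) (held: `book:gelfand2016-generalized-functions-volume-1`, chunk
  p0063). [GelfandShilov2016]
* A. G. Ramm, Modern Math. Methods 2 (2024) 19–26, (1.19) p. 22, (1.28)–(1.29) p. 23 (claim C04 of
  cell ns-claims; skeleton `Literature/Claims/NS/Ramm2024.lean`). [Ramm2024]

WHAT THIS IS NOT: not a claim about NS regularity or blow-up; not a claim about any author beyond
the typed locator.
-/

noncomputable section

open Set MeasureTheory Real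
open Literature.Analysis.Asymptotics

namespace Literature.Barriers.NavierStokesRegularity

/-- **Barrier (T4-a, regularised divergent inequality): the analytically continued / finite-part
value of a divergent convolution integral of a positive function can be negative.** There exist
`b, w : ℝ → ℝ` with `b > 0` on `(0,∞)` (indeed `b ≡ 1`), `w` continuous on `(0,∞)`, the Laplace
integrals of `b` and `w` convergent for every `p > 0` and `(Lw)(p) = p^{1/4} (Lb)(p)` — i.e. `w` is
the hyper-singular convolution `Φ_{-1/4} ⋆ b = L^{-1}(p^{1/4} Lb)` defined by analytic continuation
of `LΦ_λ = p^{-λ}` — such that `Γ(-1/4) · w(t) < 0` for all `t > 0`: the regularised value of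
«`∫₀ᵗ (t-s)^{-5/4} b(s) ds`» is negative although the integrand is positive (Gel'fand–Shilov I,
Ch. I §3.8 (3) at `λ = -5/4`: `∫₀ᵇ x^{-5/4} dx = -4 b^{-1/4}` in the regularised sense).
[cite: GelfandShilov2016, Ch. I §3.8 eq. (3)]

BARRIER (structured block, D-0021):
technique_class: transform-asymptotics integral-inequality hyper-singular-kernel hadamard-finite-part analytic-continuation-regularisation fractional-calculus laplace-transform-majorant paradox-arguments
blocks: arguments that derive sign or size information about a solution-dependent non-negative quantity `b(t)` (e.g. `‖∇v(·,t)‖₂` of a Navier–Stokes solution through the Fourier–Duhamel formula) from an integral inequality `b ≤ b₀ + c ∫₀ᵗ (t-s)^{λ-1} b(s) ds` with a NON-INTEGRABLE kernel (`λ ≤ 0`; classically the right-hand side is `+∞` and the inequality is vacuously true) by re-reading the divergent integral as its analytic continuation / Hadamard finite part `Γ(λ) (Φ_λ ⋆ b)` and then treating the re-read inequality as valid — adjudicated instance: claim C04 `Ramm2024`, `Literature.Claims.NS.Ramm2024.Step3_hyperSingularIneq` ((1.19) p. 22 → (1.29) p. 23, `λ = -1/4`), whence the «NSP paradox» `b(0)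 = 0` [cite: Ramm2024, (1.19) p. 22 and (1.29) p. 23].
because: the regularisation `λ ↦ ∫₀ᵇ x^λ dx := b^{λ+1}/(λ+1)` (`λ ≠ -1, -2, …`) is the analytic continuation of a positive functional but is itself NOT positive: at `λ = -5/4` it assigns the value `-4 b^{-1/4} < 0` to the integral of the positive function `x^{-5/4}` [cite: GelfandShilov2016, Ch. I §3.8 eqs. (2)–(3)]; in Laplace form `Φ_{-1/4} ⋆ 1 = Φ_{3/4} = t^{-1/4}/Γ(3/4) > 0` and `Γ(-1/4) = -4Γ(3/4) < 0` (this entry, proved: `finitePartRegularisationNotMonotone_holds`), so with `b = b₀ ≡ 1` the re-read inequality `b ≤ b₀ - c|Γ(-1/4)| Φ_{-1/4} ⋆ b` is false for every `c > 0` at every `t > 0` (`regularised_ineq_fails`) while the classical one holds; hence no valid inference leads from the classical (divergent) inequality to the regularised one, and any conclusion drawn from the latter is unsupported.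
evasions_known: NONE within the class — the finite part is linear and agrees with the classical integral whenever the latter converges (`λ > 0`: `Φ_λ ⋆ b` is the Riemann–Liouville integral, positive for positive `b`; tree `Literature.Analysis.ODE.RiemannLiouville`), so arguments whose kernels are integrable (`(t-s)^{-α}`, `α < 1`: Henry-type singular Grönwall lemmas, tree `Literature/Analysis/ODE/SingularGronwall.lean`, `WeaklySingularGronwallZero.lean`, `AbelVolterraMajorants.lean`) are unaffected; the barrier concerns only the passage through a divergent (`α ≥ 1`) kernel [cite: GelfandShilov2016, Ch. I §3.8].
scope_caveats: (i) the entry is a statement about real functions and their Laplace transforms, not about Navier–Stokes: it certifies that the inference pattern is invalid, not that any particular conclusion reached through it is false (for C04 the conclusion `v₀ = 0` is independently contradicted by small-data global regularity, tree `Literature.Analysis.FluidPDE.FujitaKatoGlobal`); (ii) the witness is the constant function; for the actual `b(t) = ‖|ξ|ṽ(ξ,t)‖` of a smooth solution with `∇v₀ ≠ 0` the same sign reversal occurs near `t = 0⁺` (`Γ(-1/4)(Φ_{-1/4} ⋆ b)(t) ~ -4 b(0) t^{-1/4} → -∞`, referee RETYPE R#1 for C04), which is the refuter's kernel theorem in `Summits/…/Theorems/SoloRefuteRamm2024.lean`,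 not restated here; (iii) exponent `λ = -1/4` (kernel `(t-s)^{-5/4}`, the `L²(ℝ³)` norm of `|ξ| e^{-ν(t-s)|ξ|²}`) is the one that occurs in the adjudicated claim; the same computation gives `Γ(λ) Φ_λ ⋆ 1 = t^λ/λ < 0` for every `λ ∈ (-1, 0)`.
status: established -/
def FinitePartRegularisationNotMonotone : Prop :=
  ∃ b w : ℝ → ℝ,
    (∀ t : ℝ, 0 < t → 0 < b t) ∧ ContinuousOn w (Ioi 0) ∧
    (∀ p : ℝ, 0 < p →
      IntegrableOn (fun t => b t * exp (-(p * t))) (Ioi 0) ∧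
      IntegrableOn (fun t => w t * exp (-(p * t))) (Ioi 0) ∧
      KaramataLaplace.laplace w p = p ^ (-(-(1 / 4 : ℝ))) * KaramataLaplace.laplace b p) ∧
    ∀ t : ℝ, 0 < t → Gamma (-(1 / 4 : ℝ)) * w t < 0

/-- `Γ(-1/4) = -4 Γ(3/4)` (functional equation `Γ(s+1) = s Γ(s)` at `s = -1/4`).
[cite: AbramowitzStegun1964, 6.1.15] -/
theorem Gamma_neg_quarter : Gamma (-(1 / 4 : ℝ)) = -4 * Gamma (3 / 4 : ℝ) := by
  have h := Gamma_add_one (s := -(1 / 4 : ℝ)) (by norm_num)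
  rw [show -(1 / 4 : ℝ) + 1 = 3 / 4 by norm_num] at h
  rw [h]
  ring

/-- `Γ(-1/4) < 0` (from `Γ(-1/4) = -4Γ(3/4)` and `Γ > 0` on `(0,∞)`). [cite: AbramowitzStegun1964, 6.1.15] -/
theorem Gamma_neg_quarter_neg : Gamma (-(1 / 4 : ℝ)) < 0 := by
  rw [Gamma_neg_quarter]
  have : 0 < Gamma (3 / 4 : ℝ) := Gamma_pos_of_pos (by norm_num)
  linarith

/-- `t ↦ t^{-1/4} e^{-pt}` is integrable on `(0,∞)` for `p > 0` (convergent Gamma-type integral,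
GR 3.326.2 with `n = 1`, `m = -1/4`). [cite: GradshteynRyzhik2015, 3.326.2 (n = 1)] -/
theorem integrableOn_rpow_neg_quarter_mul_exp {p : ℝ} (hp : 0 < p) :
    IntegrableOn (fun t : ℝ => t ^ (-(1 / 4 : ℝ)) * exp (-(p * t))) (Ioi 0) := by
  have h := integrableOn_rpow_mul_exp_neg_mul_rpow (s := -(1 / 4 : ℝ)) (p := 1) (b := p)
    (by norm_num) le_rfl hp
  refine (integrableOn_congr_fun (fun t _ => ?_) measurableSet_Ioi).1 h
  rw [rpow_one, neg_mul]

/-- **`L(t^{-1/4})(p) = Γ(3/4) · p^{-3/4}`** for `p > 0` (Mathlib's Gamma integral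
`∫₀^∞ t^{a-1} e^{-pt} dt = p^{-a} Γ(a)` at `a = 3/4`; GR 3.326.2 with `n = 1`).
[cite: GradshteynRyzhik2015, 3.326.2 (n = 1)] -/
theorem laplace_rpow_neg_quarter {p : ℝ} (hp : 0 < p) :
    KaramataLaplace.laplace (fun t : ℝ => t ^ (-(1 / 4 : ℝ))) p =
      Gamma (3 / 4 : ℝ) * p ^ (-(3 / 4 : ℝ)) := by
  unfold KaramataLaplace.laplace
  have h := Real.integral_rpow_mul_exp_neg_mul_Ioi (a := (3 / 4 : ℝ)) (r := p) (by norm_num) hp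
  rw [show (3 / 4 : ℝ) - 1 = -(1 / 4) by norm_num] at h
  rw [h, one_div, inv_rpow hp.le, rpow_neg hp.le]
  ring

/-- **Discharge of the entry** with `b ≡ 1`, `w(t) = t^{-1/4}/Γ(3/4) = Φ_{3/4}(t) = (Φ_{-1/4} ⋆ 1)(t)`:
`L1 = 1/p`, `Lw = p^{-3/4} = p^{1/4} · (1/p)`, and `Γ(-1/4) w(t) = -4 t^{-1/4} < 0`.
[cite: GelfandShilov2016, Ch. I §3.8 eq. (3)] -/
theorem finitePartRegularisationNotMonotone_holds : FinitePartRegularisationNotMonotone := by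
  have hG : 0 < Gamma (3 / 4 : ℝ) := Gamma_pos_of_pos (by norm_num)
  refine ⟨fun _ => 1, fun t => t ^ (-(1 / 4 : ℝ)) / Gamma (3 / 4 : ℝ), fun _ _ => one_pos, ?_, ?_, ?_⟩
  · -- continuity on `(0,∞)`
    refine ContinuousOn.div_const (fun t ht => ?_) _
    exact (continuousAt_rpow_const _ _ (Or.inl (ne_of_gt ht))).continuousWithinAt
  · intro p hp
    refine ⟨KaramataLaplace.hint_one p hp, ?_, ?_⟩
    · have h := (integrableOn_rpow_neg_quarter_mul_exp hp).div_const (Gamma (3 / 4 : ℝ))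
      refine (integrableOn_congr_fun (fun t _ => ?_) measurableSet_Ioi).1 h
      ring
    · rw [KaramataLaplace.laplace_one hp]
      have hw : KaramataLaplace.laplace (fun t : ℝ => t ^ (-(1 / 4 : ℝ)) / Gamma (3 / 4 : ℝ)) p =
          KaramataLaplace.laplace (fun t : ℝ => t ^ (-(1 / 4 : ℝ))) p / Gamma (3 / 4 : ℝ) := by
        unfold KaramataLaplace.laplace
        rw [← integral_div]
        refine setIntegral_congr_fun measurableSet_Ioi fun t _ => ?_
        ring
      rw [hw, laplace_rpow_neg_quarter hp, neg_neg, one_div]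
      rw [show p ^ (-(3 / 4 : ℝ)) = p ^ (1 / 4 : ℝ) * p⁻¹ by
        rw [← rpow_neg_one, ← rpow_add hp]; norm_num]
      field_simp
  · intro t ht
    rw [Gamma_neg_quarter]
    have hpow : 0 < t ^ (-(1 / 4 : ℝ)) := rpow_pos_of_pos ht _
    have : -4 * Gamma (3 / 4 : ℝ) * (t ^ (-(1 / 4 : ℝ)) / Gamma (3 / 4 : ℝ)) = -4 * t ^ (-(1 / 4 : ℝ)) := by
      field_simp
    rw [this]
    linarith

/-- **Consequence in the shape of the adjudicated step.** With `b = b₀ ≡ 1` (so `b ≤ b₀`, and the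
classical inequality `b ≤ b₀ + c∫₀ᵗ(t-s)^{-5/4} b` holds, its right-hand side being `+∞`), the
regularised inequality `b(t) ≤ b₀(t) - c · |Γ(-1/4)| · (Φ_{-1/4} ⋆ b)(t)` (the form of Ramm 2024
(1.29) p. 23, `c₁ = |Γ(-1/4)|`) FAILS at every `t > 0`, for every `c > 0`. Hence «classical
divergent inequality ⇒ regularised inequality» is not a valid inference.
[cite: GelfandShilov2016, Ch. I §3.8 eq. (3)] -/
theorem FinitePartRegularisationNotMonotone.regularised_ineq_fails
    (h : FinitePartRegularisationNotMonotone) :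
    ∃ b w : ℝ → ℝ,
      (∀ t : ℝ, 0 < t → 0 < b t) ∧ ContinuousOn w (Ioi 0) ∧
      (∀ p : ℝ, 0 < p →
        IntegrableOn (fun t => b t * exp (-(p * t))) (Ioi 0) ∧
        IntegrableOn (fun t => w t * exp (-(p * t))) (Ioi 0) ∧
        KaramataLaplace.laplace w p = p ^ (-(-(1 / 4 : ℝ))) * KaramataLaplace.laplace b p) ∧
      ∀ c : ℝ, 0 < c → ∀ t : ℝ, 0 < t → ¬ (b t ≤ b t - c * |Gamma (-(1 / 4 : ℝ))| * w t) := by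
  obtain ⟨b, w, hb, hw, hL, hneg⟩ := h
  refine ⟨b, w, hb, hw, hL, fun c hc t ht hle => ?_⟩
  have hΓ : Gamma (-(1 / 4 : ℝ)) < 0 := Gamma_neg_quarter_neg
  have hwpos : 0 < w t := by
    have := hneg t ht
    nlinarith
  have habs : |Gamma (-(1 / 4 : ℝ))| = -Gamma (-(1 / 4 : ℝ)) := abs_of_neg hΓ
  rw [habs] at hle
  nlinarith [mul_pos hc hwpos]

end Literature.Barriers.NavierStokesRegularity

end
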